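/-
HONEST FRAMING: certified error envelopes and provably optimal rounding/accumulation schemes for
low-precision formats under stated cost models; every table by two implementations; no hardware
or vendor claims.
-/
import Summits.Ventures.CertifiedArithmetic.LowPrec.OptDemotionRoutingTT

/-!
# The demotion law (Theorem T8), part 10a: the local routing lemma from GOOD TOP PAIRS

Part 8n (`LRL_of_TT`) proves opt's local routing lemma `LRL q` in two moves: the RAISE (every
admissible pair of child configurations is dominated, by monotonicity (M), by a TOP PAIR
`(n + ½ | m - n)`) and the DESCENT of part 8m (every top pair is dominated by a bit partition,
from opt's two-tree inequality `TT q`).  THIS FILE isolates the raise as a theorem of its own: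
`AllTopGood q` — every top pair of every budget is good, `2^(q-1) + BR_a(n + ½) + BR_b(m - n) ≤
BR_(a·b)(bits m)` (part 8m `TopGood`) — implies `LRL q` (`LRL_of_allTopGood`), hence the routing
conjecture for every shape and Conjecture D for every tree (`conjectureD_of_allTopGood`).  The
proof is part 8n's, with the descent abstracted into the hypothesis; part 10b feeds it opt gen 15's
refined descent (R29: un-carry the LARGEST common bit), which needs the two-tree inequality only
for offsets `A, B < β`.
-/

namespace Summit.Ventures.CertifiedArithmetic.LowPrec.Opt

open Literature.ComputerArithmetic.JeannerodRump2018
open Literature.ComputerArithmetic.JeannerodRump2018.SumTree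

section TopGood

variable {q : ℕ}

/-- ALL TOP PAIRS ARE GOOD at precision `q`: for every pair of subtrees, every budget mantissa
`m ∈ [2^(q-1), 2^q)` and every `n < 2^(q-1)`, `n ≤ m`:
`2^(q-1) + BR_a(n + ½) + BR_b(m - n) ≤ BR_(a·b)(bits m)` (part 8m `TopGood`). -/
def AllTopGood (q : ℕ) : Prop :=
  ∀ (a b : SumTree) (m : ℕ), 2 ^ (q - 1) ≤ m → m < 2 ^ q →
    ∀ n : ℕ, n < 2 ^ (q - 1) → n ≤ m → TopGood q a b m n

/-- `TT q` gives all top pairs (part 8m). -/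
theorem allTopGood_of_TT (hq : 2 ≤ q) (hTT : TT q) : AllTopGood q :=
  fun a b _ hm hm' n hn hnm => (topGood_of_TT hq hTT a b hm hm' _ n hn hnm le_rfl).1

/-- **THE RAISE: opt's LOCAL ROUTING LEMMA FROM GOOD TOP PAIRS** (`q ≥ 1`): if every top pair is
good, every admissible pair of child configurations is dominated by the best bit partition of
`bits m ∪ {-1}` (the proof of part 8n `LRL_of_TT` with the descent as a hypothesis). -/
theorem LRL_of_allTopGood (hq1 : 1 ≤ q) (hG : AllTopGood q) : LRL q := by
  intro a b m hm hm' A B hA hB hxm hym hsum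
  set x := val A with hxdef
  set y := val B with hydef
  set H : ℚ := (2 : ℚ) ^ ((q : ℤ) - 1) with hHdef
  have hHnat : ((2 ^ (q - 1) : ℕ) : ℚ) = H := by rw [hHdef]; push_cast; exact two_pow_pred hq1
  have hm1 : 1 ≤ m := le_trans Nat.one_le_two_pow hm
  have hhalf : 2 ^ (q - 1) + 2 ^ (q - 1) = 2 ^ q := (two_pow_eq_half_add_half hq1).symm
  -- every top pair is good, both orientations
  have G : ∀ n : ℕ, n < 2 ^ (q - 1) → n ≤ m →
      H + treeBRv q a ((n : ℚ) + 1 / 2) + treeBRv q b ((m - n : ℕ) : ℚ) ≤ treeBR q (.node a b) (natBits m) ∧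
      H + treeBRv q b ((n : ℚ) + 1 / 2) + treeBRv q a ((m - n : ℕ) : ℚ) ≤ treeBR q (.node a b) (natBits m) := by
    intro n hn hnm
    have h1 := hG a b m hm hm' n hn hnm
    have h2 := hG b a m hm hm' n hn hnm
    unfold TopGood at h1 h2
    have hcomm : treeBR q (.node b a) (natBits m) = treeBR q (.node a b) (natBits m) := by
      unfold treeBR; exact treeBRw_node_comm q _ b a _
    rw [hcomm] at h2
    exact ⟨h1, h2⟩
  -- dominations
  have domA : ∀ z : ℚ, IsQFloat q z → x ≤ z → treeBR q a A ≤ treeBRv q a z :=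
    fun z hz hle => treeBR_le_treeBRv hq1 a hA hz hle
  have domB : ∀ z : ℚ, IsQFloat q z → y ≤ z → treeBR q b B ≤ treeBRv q b z :=
    fun z hz hle => treeBR_le_treeBRv hq1 b hB hz hle
  -- useful floats
  have Fhalf : ∀ n : ℕ, n < 2 ^ (q - 1) → IsQFloat q ((n : ℚ) + 1 / 2) := fun n hn => isQFloat_half hq1 hn
  have Fnat : ∀ n : ℕ, 1 ≤ n → n ≤ m → IsQFloat q (n : ℚ) := fun n h1 h2 =>
    isQFloat_natCast h1 (by omega)
  ------------------------------------------------------------------ (i) x ≤ ½ : partition (½ | m)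
  by_cases hxs : x ≤ 1 / 2
  · have h := (G 0 (Nat.two_pow_pos _) (Nat.zero_le _)).1
    simp only [Nat.cast_zero, zero_add, Nat.sub_zero] at h
    have h1 := domA (1 / 2) (by have := Fhalf 0 (Nat.two_pow_pos _); simpa using this) hxs
    have h2 := domB m (Fnat m hm1 le_rfl) hym
    linarith
  ------------------------------------------------------------------ (ii) y ≤ ½ : partition (m | ½)
  by_cases hys : y ≤ 1 / 2
  · have h := (G 0 (Nat.two_pow_pos _) (Nat.zero_le _)).2
    simp only [Nat.cast_zero, zero_add, Nat.sub_zero] at h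
    have h1 := domB (1 / 2) (by have := Fhalf 0 (Nat.two_pow_pos _); simpa using this) hys
    have h2 := domA m (Fnat m hm1 le_rfl) hxm
    linarith
  have hxs : 1 / 2 < x := not_le.1 hxs
  have hys : 1 / 2 < y := not_le.1 hys
  have hAne : A.Nonempty := by
    by_contra h; rw [Finset.not_nonempty_iff_eq_empty] at h
    rw [hxdef, h, val_empty] at hxs; linarith
  have hBne : B.Nonempty := by
    by_contra h; rw [Finset.not_nonempty_iff_eq_empty] at h
    rw [hydef, h, val_empty] at hys; linarith
  have hxF : IsQFloat q x := isQFloat_val hAne hA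
  have hyF : IsQFloat q y := isQFloat_val hBne hB
  ------------------------------------------------------------------ (iii) x ≥ σ : x = N integer, b-odd top pair n = m - N
  by_cases hxH : H ≤ x
  · obtain ⟨hne, hS, hv⟩ := hxF.bitsOf
    have hge0 : ∀ e ∈ bitsOf x, (0 : ℤ) ≤ e := by
      intro e he
      have htop : (q : ℤ) - 1 ≤ (bitsOf x).max' hne := by
        by_contra h
        have h1 := val_lt_two_zpow (bitsOf x) hne
        have h2 : 2 * (2 : ℚ) ^ ((bitsOf x).max' hne) ≤ H := by
          rw [hHdef, ← zpow_one_add₀ (two_ne_zero)]; exact zpow_le_zpow_right₀ (by norm_num) (by omega)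
        rw [hv] at h1; linarith
      have := hS _ (Finset.max'_mem _ hne) e he; linarith
    obtain ⟨N, hN⟩ := val_eq_nat_mul hge0
    rw [hv, zpow_zero, mul_one] at hN
    have hNm : N ≤ m := by have : (N : ℚ) ≤ m := hN ▸ hxm; exact_mod_cast this
    have hNH : 2 ^ (q - 1) ≤ N := by
      have : H ≤ N := hN ▸ hxH; rw [← hHnat] at this; exact_mod_cast this
    set n := m - N with hn
    have hnlt : n < 2 ^ (q - 1) := by omega
    have h := (G n hnlt (Nat.sub_le m N)).2
    have hmn : m - n = N := by omega
    rw [hmn] at h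
    have h1 := domB ((n : ℚ) + 1 / 2) (Fhalf n hnlt) (by rw [hn]; push_cast [Nat.cast_sub hNm]; linarith)
    have h2 := domA (N : ℚ) (Fnat N (le_trans Nat.one_le_two_pow hNH) hNm) (le_of_eq hN)
    linarith
  ------------------------------------------------------------------ (iv) y ≥ σ : symmetric, a-odd n = m - N
  by_cases hyH : H ≤ y
  · obtain ⟨hne, hS, hv⟩ := hyF.bitsOf
    have hge0 : ∀ e ∈ bitsOf y, (0 : ℤ) ≤ e := by
      intro e he
      have htop : (q : ℤ) - 1 ≤ (bitsOf y).max' hne := by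
        by_contra h
        have h1 := val_lt_two_zpow (bitsOf y) hne
        have h2 : 2 * (2 : ℚ) ^ ((bitsOf y).max' hne) ≤ H := by
          rw [hHdef, ← zpow_one_add₀ (two_ne_zero)]; exact zpow_le_zpow_right₀ (by norm_num) (by omega)
        rw [hv] at h1; linarith
      have := hS _ (Finset.max'_mem _ hne) e he; linarith
    obtain ⟨N, hN⟩ := val_eq_nat_mul hge0
    rw [hv, zpow_zero, mul_one] at hN
    have hNm : N ≤ m := by have : (N : ℚ) ≤ m := hN ▸ hym; exact_mod_cast this
    have hNH : 2 ^ (q - 1) ≤ N := by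
      have : H ≤ N := hN ▸ hyH; rw [← hHnat] at this; exact_mod_cast this
    set n := m - N with hn
    have hnlt : n < 2 ^ (q - 1) := by omega
    have h := (G n hnlt (Nat.sub_le m N)).1
    have hmn : m - n = N := by omega
    rw [hmn] at h
    have h1 := domA ((n : ℚ) + 1 / 2) (Fhalf n hnlt) (by rw [hn]; push_cast [Nat.cast_sub hNm]; linarith)
    have h2 := domB (N : ℚ) (Fnat N (le_trans Nat.one_le_two_pow hNH) hNm) (le_of_eq hN)
    linarith
  have hxH : x < H := not_le.1 hxH
  have hyH : y < H := not_le.1 hyH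
  ------------------------------------------------------------------ (v) both in (½, σ): trichotomy
  have hHq : H = ((2 ^ (q - 1) : ℕ) : ℚ) := hHnat.symm
  have closeA : ∀ n : ℕ, n < 2 ^ (q - 1) → n ≤ m → x ≤ (n : ℚ) + 1 / 2 → y ≤ ((m - n : ℕ) : ℚ) →
      H + treeBR q a A + treeBR q b B ≤ treeBR q (.node a b) (natBits m) := by
    intro n hn hnm hxa hyb
    have h := (G n hn hnm).1
    have h1 := domA _ (Fhalf n hn) hxa
    have h2 := domB _ (Fnat (m - n) (by
      by_contra h0; push_cast [Nat.cast_sub hnm] at hyb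
      have : m - n = 0 := by omega
      have : (m : ℚ) - n ≤ 0 := by
        have : (m : ℚ) ≤ n := by exact_mod_cast (Nat.sub_eq_zero_iff_le.1 this)
        linarith
      linarith) (Nat.sub_le m n)) hyb
    linarith
  have closeB : ∀ n : ℕ, n < 2 ^ (q - 1) → n ≤ m → y ≤ (n : ℚ) + 1 / 2 → x ≤ ((m - n : ℕ) : ℚ) →
      H + treeBR q a A + treeBR q b B ≤ treeBR q (.node a b) (natBits m) := by
    intro n hn hnm hyb hxa
    have h := (G n hn hnm).2
    have h1 := domB _ (Fhalf n hn) hyb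
    have h2 := domA _ (Fnat (m - n) (by
      by_contra h0; push_cast [Nat.cast_sub hnm] at hxa
      have : m - n = 0 := by omega
      have : (m : ℚ) - n ≤ 0 := by
        have : (m : ℚ) ≤ n := by exact_mod_cast (Nat.sub_eq_zero_iff_le.1 this)
        linarith
      linarith) (Nat.sub_le m n)) hxa
    linarith
  show H + treeBR q a A + treeBR q b B ≤ treeBR q (.node a b) (natBits m)
  rcases isQFloat_trichotomy hxF with ⟨N, hN⟩ | ⟨N, hN⟩ | hxoff
  · ---- x = N integer (1 ≤ N < 2^(q-1))
    have hNlt : N < 2 ^ (q - 1) := by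
      have : (N : ℚ) < ((2 ^ (q - 1) : ℕ) : ℚ) := by rw [← hHq, ← hN]; exact hxH
      exact_mod_cast this
    have hNm : N ≤ m := by have : (N : ℚ) ≤ m := hN ▸ hxm; exact_mod_cast this
    by_cases hyN : y ≤ ((m - N : ℕ) : ℚ)
    · exact closeA N hNlt hNm (by rw [hN]; linarith) hyN
    · have hyN := not_le.1 hyN
      have hnlt : m - N < 2 ^ (q - 1) := by
        have : ((m - N : ℕ) : ℚ) < ((2 ^ (q - 1) : ℕ) : ℚ) := by rw [← hHq]; linarith
        exact_mod_cast this
      refine closeB (m - N) hnlt (Nat.sub_le m N) ?_ ?_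
      · push_cast [Nat.cast_sub hNm]; linarith
      · rw [show m - (m - N) = N by omega, hN]
  · ---- x = N + ½ odd half-integer: a-odd with n = N (o = x exactly)
    have hNlt : N < 2 ^ (q - 1) := by
      have : (N : ℚ) < ((2 ^ (q - 1) : ℕ) : ℚ) := by rw [← hHq]; linarith
      exact_mod_cast this
    have hNm : N ≤ m := by
      have : (N : ℚ) ≤ m := by linarith
      exact_mod_cast this
    exact closeA N hNlt hNm (le_of_eq hN) (by push_cast [Nat.cast_sub hNm]; linarith)
  · ---- x has a bit below ¼, so x ≤ 2^(q-2) - ¼; trichotomy on y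
    rcases isQFloat_trichotomy hyF with ⟨N, hN⟩ | ⟨N, hN⟩ | hyoff
    · have hNlt : N < 2 ^ (q - 1) := by
        have : (N : ℚ) < ((2 ^ (q - 1) : ℕ) : ℚ) := by rw [← hHq, ← hN]; exact hyH
        exact_mod_cast this
      have hNm : N ≤ m := by have : (N : ℚ) ≤ m := hN ▸ hym; exact_mod_cast this
      by_cases hxN : x ≤ ((m - N : ℕ) : ℚ)
      · exact closeB N hNlt hNm (by rw [hN]; linarith) hxN
      · have hxN := not_le.1 hxN
        have hnlt : m - N < 2 ^ (q - 1) := by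
          have : ((m - N : ℕ) : ℚ) < ((2 ^ (q - 1) : ℕ) : ℚ) := by rw [← hHq]; linarith
          exact_mod_cast this
        refine closeA (m - N) hnlt (Nat.sub_le m N) ?_ ?_
        · push_cast [Nat.cast_sub hNm]; linarith
        · rw [show m - (m - N) = N by omega, hN]
    · have hNlt : N < 2 ^ (q - 1) := by
        have : (N : ℚ) < ((2 ^ (q - 1) : ℕ) : ℚ) := by rw [← hHq]; linarith
        exact_mod_cast this
      have hNm : N ≤ m := by
        have : (N : ℚ) ≤ m := by linarith
        exact_mod_cast this
      exact closeB N hNlt hNm (le_of_eq hN) (by push_cast [Nat.cast_sub hNm]; linarith)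
    · have h22 : (2 : ℚ) ^ ((q : ℤ) - 2) + (2 : ℚ) ^ ((q : ℤ) - 2) = H := by
        rw [hHdef, ← two_mul, ← zpow_one_add₀ (two_ne_zero)]; congr 1; ring
      have hxy : x + y ≤ (m : ℚ) - 1 / 2 := by
        have hHm : H ≤ m := by rw [← hHnat]; exact_mod_cast hm
        linarith
      set n := ⌈x - 1 / 2⌉₊ with hndef
      have hn1 : x - 1 / 2 ≤ n := Nat.le_ceil _
      have hn2 : (n : ℚ) < x - 1 / 2 + 1 := Nat.ceil_lt_add_one (by linarith)
      have hnlt : n < 2 ^ (q - 1) := by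
        have : (n : ℚ) < ((2 ^ (q - 1) : ℕ) : ℚ) := by
          rw [← hHq]; have : (0 : ℚ) < (2 : ℚ) ^ ((q : ℤ) - 2) := zpow_pos (by norm_num) _; linarith
        exact_mod_cast this
      have hnm : n ≤ m := by
        have : (n : ℚ) ≤ m := by linarith
        exact_mod_cast this
      exact closeA n hnlt hnm (by linarith) (by push_cast [Nat.cast_sub hnm]; linarith)

/-- The routing conjecture for every shape from good top pairs (`q ≥ 1`). -/
theorem routingBound_of_allTopGood (hq1 : 1 ≤ q) (hG : AllTopGood q) (s : Shape) :
    RoutingBound q s :=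
  routingBound_of_LRL hq1 (LRL_of_allTopGood hq1 hG) s

/-- **CONJECTURE D FOR EVERY TREE FROM GOOD TOP PAIRS**: for `q ≥ 1` with `AllTopGood q`, every
`p ≥ 1`, any nearest roundings into `F(q, emin)` and `F(p, emin)`, and every summation tree of
nonnegative `F(q, emin)` data: `s ≤ Q_t · fl_p(ŝ)`. -/
theorem conjectureD_of_allTopGood {p : ℕ} (hp : 1 ≤ p) (hq1 : 1 ≤ q) (hG : AllTopGood q)
    {emin : ℤ} {fl flp : ℚ → ℚ} (hfl : IsRoundNearest q emin fl) (hflp : IsRoundNearest p emin flp)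
    (t : SumTree) (ht : ∀ x ∈ leaves t, IsFloat q emin x ∧ 0 ≤ x) :
    exact t ≤ treeQf (unitRoundoff q) t (unitRoundoff p) * flp (eval fl t) :=
  conjectureD_of_LRL hp hq1 (LRL_of_allTopGood hq1 hG) hfl hflp t ht

end TopGood

end Summit.Ventures.CertifiedArithmetic.LowPrec.Opt
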